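/-
Copyright (c) 2026 the pub-hodgecm-mathlib formalisation cell (harness21).  Prover seat hodgecm-mathlib-K2E1-p16 (g0), Track B ∕ K2-LIT, h413 = `stmt-HodgeConjecture-24833`,
line `K2_E1_TraceFormulaBeta`, route of record `HCCMUnconditional`; dealer K2E1-plan (g7) (272): G6-inst FILE 3 of ROADCARD 5Res AMENDMENT #3 «GENERAL (U,τ) LADDER» — the LEVEL∕ω
twin of ★ `K2E1ChiScatteringRealPolesM1CMTwoLetterFree`: the (d)-realness road for the WHOLE SCATTERING MATRIX of a self-dual unitary `χ` at a `c_G`-stable finite-index level, the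
reflection socket (conj) CLOSED by ★ G7 `chi_scattering_matrix_conj_symm_level_final_cm_two` in `c_G`-real bases — modulo `hdec` (constant-term decay) and the AXIS letter only.
-/
import Summits.HodgeConjecture.HodgeConjecture.Theorems.K2E1ChiScatteringRealPolesLevelCMTwoFinal        -- ★ p861004 (this seat): level `L²(K_max)` trivia; brings ★ p860981 `…_matrix`, ★ p860918 G4 export, ★ `idelicBracket_pos`
import Summits.HodgeConjecture.HodgeConjecture.Theorems.K2E1ChiScatteringConjSymmetryLevelCMTwoFinal    -- ★ p860912 G7 HEAD (K2E1-p13): `chi_scattering_matrix_conj_symm_level_final_cm_two`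
import Summits.HodgeConjecture.HodgeConjecture.Theorems.K2E1ChiSectionBoundedOfUnitaryU2                -- ★ p860823 (K2E1-p15): `exists_bound_of_isChiSection_of_isUnitary`
import HarnessLib

/-!
# K2·E1 — `K2E1ChiScatteringRealPolesLevelCMTwoLetterFree`: `hreal` AND `hs` FOR THE WHOLE CONTINUED SCATTERING MATRIX OF A SELF-DUAL UNITARY `χ` OF `U(1,1)_{L∕L⁺}` AT A `c_G`-STABLE
# FINITE-INDEX LEVEL `(K′, ω)`, WITH THE REFLECTION SOCKET CLOSED — modulo `hdec` (constant-term decay) and the axis letter only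

Track B ∕ K2-LIT, crux h413 = `stmt-HodgeConjecture-24833`; cell `hodgecm-mathlib`, squad K2, ENGINE E1, campaign «5Res», AMENDMENT #3 rung G6 («`hreal ∧ hs` at general `(U,τ)`»; consumer: the
self-dual block package at level in ★ `K2E1SpanOperatorMatrixLetters` currency — `hm : ∀ c a, DifferentiableOn ℂ (m · c a) D`, `m z c a := qc a c z`, `D := U′ ∖ ↑S`).  THEOREMS ONLY (no `def`,
no `instance`, no notation, no named-fact hypothesis, no `sorry`; default heartbeats); lane `--kind proof --supports stmt-HodgeConjecture-24833 --as helper` (count-neutral).  Closes no socket.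

THE MATHEMATICS ([MoeglinWaldspurger1995, II.1.7, IV.1.10–IV.1.11, IV.3.12 (a)]; [Langlands1976, §7]; [BernsteinLapid2019, Thm 2.3, §4]).  At a general level the `χ`-block has RANK
`n = dim V(χ, K′, ω) ≥ 1` and the scattering operator is a MATRIX: the rank-one devices of ★ `…M1CMTwoLetterFree` (singleton basis `{φ}`, the scattering SCALAR `s = qc default` with its tube
formula, `φ(1) ≠ 0` real, ★ p860445's scalar reflection symmetry) have no analogue.  Instead: ★ G7 `chi_scattering_matrix_conj_symm_level_final_cm_two` provides, for `χ` self-dual unitary and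
`K′` of finite index in `K_max` with `c_G(K′) ⊆ K′` and `conj ω = ω ∘ c_G`, `c_G`-REAL bases `b` of `V(χ, K′, ω)` (the COLUMNS) and `b′` of `V(χʷ, K′, ω)` (the COORDINATES) in which EVERY
continued package has `qc_{ij}(conj z) = conj qc_{ij}(z)` off its pole set.  For each column `b_i` (continuous by `hVc`, bounded since `χ` is unitary ★ `exists_bound_of_isChiSection_of_isUnitary`)
★ p860918 `chiEisenstein_family_export_level_cm_two` gives the package `(q_i, Ec_i, qc_i, P_i)` with (E1)–(E4) and the per-ball truncated families of the SAME `Ec_i`; all columns are read through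
the ONE pole set `P := ⋃_i P_i` (closed, co-discrete, `⊆ {Re ≤ 1}`; every package clause is monotone in the pole set), on which G7 closes (conj) for all entries at once.  Then ★ p860981
`chi_scattering_hs_of_model_level_cm_two_matrix` (B2's χ-Maass–Selberg relation in the `L²(K_max)`-model, column by column, with the `L²(K_max)`-classes of ★ p861004 §1: non-zero for the
basis vectors `b_i ≠ 0`, linearly independent for `b′`; `κ > 0` ★ `idelicBracket_pos`) yields, GIVEN the axis letter, `hreal` for every entry and ONE finset `S ⊂ (½, σ₀)` of real poles with
ONE open `U′ ⊇ {½ ≤ Re ≤ σ₀}` off which every entry `qc_{ij}` is holomorphic.  RESULT **`chi_scattering_real_poles_level_letterFree_cm_two`**: `∃` real bases `b, b′`, `∃ (q, Ec, qc, P)` with,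
per column, ★ p860918's clauses (relative to the common `P`) and the families, **(conj) for all entries PROVED**, and the bill «`∀ σ₀ > 1`, (axis) → `(∀ i j, hreal_{ij}) ∧ ∃ S U′, …`» — under
the ONE outer socket `hdec` (constant-term decay of `E(f_{z′}^φ)` above every truncation level for every section `φ` of the block; level payer ★ p860970
`K2E1ChiMaassSelbergDecayLetterLevelCMTwo.hdec_level_cm_two_of_lineSymbol`, itself modulo the arch line-symbol letter) and G7's level letters `hfi`, `hK`, `hω`.  The axis letter is paid,
entry by entry, by ★ p860958 `K2E1ChiScatteringMatrixAxisNoPoleU2.analyticAt_coord_of_re_eq_half` from the level MATRIX functional equation (★ `K2E1ChiScatteringMatrixFunctionalEquationLevelCMTwo`)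
and the K-pairing adjointness — the Complete-level file.
SATISFIABILITY of the structural binders: the level binders are ★ p860918's VERBATIM (owner K2-defs1; M1 instance `K′ = K_max`, `ω = 1`, `U₀` = finite part of the standard maximal compact) and
G7's `hfi ∕ hK ∕ hω` are ★ p860912's VERBATIM (owner K2E1-p13; at `K′ = K_max`, `ω = 1`: index `1`, `c_G(K_max) = K_max` ★ p860364, `hω` trivial); no binder asks a subgroup of `G(𝔸)` to be
open AND compact ((278)(A)).
HONEST LABEL: HC_CM is proved only modulo the 7 printed citations (2 remaining named inputs: hLiu418 = `stmt-HodgeConjecture-24832`, h413 = `stmt-HodgeConjecture-24833`) until rung 0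
closes; this file asserts no named fact, is conditional by construction on `hdec`, on G7's level letters and on the (axis) socket inside its conclusion, and closes no socket.

## References
* [MoeglinWaldspurger1995] C. Mœglin, J.-L. Waldspurger, *Spectral decomposition and Eisenstein series* (1995), II.1.7, IV.1.10–IV.1.11, IV.3.12 (a).
* [Langlands1976] R. P. Langlands, *On the Functional Equations Satisfied by Eisenstein Series*, LNM 544 (1976), §7.
* [BernsteinLapid2019] J. Bernstein, E. Lapid, *On the meromorphic continuation of Eisenstein series*, J. AMS 37 (2024), Thm 2.3, §4.
-/

set_option autoImplicit false
set_option linter.dupNamespace false  -- the mandated namespace repeats the summit's segment (`HodgeConjecture.HodgeConjecture`)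

noncomputable section

open MeasureTheory MeasureTheory.Measure Set NumberField IsDedekindDomain Filter Topology Metric
open scoped NNReal ENNReal ComplexConjugate InnerProductSpace
open Literature.MeasureTheory.Group Literature.NumberTheory
open Literature.NumberTheory.Automorphic Literature.NumberTheory.Automorphic.UnitaryGroup AdelicGroupData
open Literature.NumberTheory.GaloisRepresentations
open Summit.HodgeConjecture.HodgeConjecture.Cruxes.H413.K2E1BorelEisensteinU
open Summit.HodgeConjecture.HodgeConjecture.Cruxes.H413.K2E1BLBorelSpacesU2Defs
open Summit.HodgeConjecture.HodgeConjecture.Cruxes.H413.K2E1BLBorelOperatorsU2Defs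
open Summit.HodgeConjecture.HodgeConjecture.Cruxes.H413.K2E1CharacterEisensteinU2Defs
open Summit.HodgeConjecture.HodgeConjecture.Cruxes.H413.K2E1ChiSectionSpaceU2Defs
open Summit.HodgeConjecture.HodgeConjecture.Cruxes.H413.K2E1ChiScatteringRealPolesOfModelLevelCMTwo (chi_scattering_hs_of_model_level_cm_two_matrix)
open Summit.HodgeConjecture.HodgeConjecture.Cruxes.H413.K2E1ChiScatteringRealPolesLevelCMTwoFinal (ne_zero_of_coeFn_ae_eq_of_continuous linearIndependent_of_coeFn_ae_eq_of_continuous)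
open Summit.HodgeConjecture.HodgeConjecture.Cruxes.H413.K2E1ChiEisensteinFamilyExportLevelCMTwo (chiEisenstein_family_export_level_cm_two)
open Summit.HodgeConjecture.HodgeConjecture.Cruxes.H413.K2E1ChiScatteringConjSymmetryLevelCMTwoFinal (chi_scattering_matrix_conj_symm_level_final_cm_two)
open Summit.HodgeConjecture.HodgeConjecture.Cruxes.H413.K2E1ChiSectionBoundedOfUnitaryU2 (exists_bound_of_isChiSection_of_isUnitary)
open Summit.HodgeConjecture.HodgeConjecture.Cruxes.H413.K2E1MaassSelbergSphericalBracketsCMThree (idelicBracket_pos)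

namespace Summit.HodgeConjecture.HodgeConjecture.Cruxes.H413.K2E1ChiScatteringRealPolesLevelCMTwoLetterFree

variable (L : Type) [Field L] [NumberField L] [IsCMField L]
variable [MeasurableSpace (quasiSplit (↥(maximalRealSubfield L)) L (IsCMField.complexConj L) 2).Adelic] [BorelSpace (quasiSplit (↥(maximalRealSubfield L)) L (IsCMField.complexConj L) 2).Adelic]
  [MeasurableSpace (arch (↥(maximalRealSubfield L)) L (IsCMField.complexConj L) 2 ((StdForm.antidiagonal 2).over L))] [BorelSpace (arch (↥(maximalRealSubfield L)) L (IsCMField.complexConj L) 2 ((StdForm.antidiagonal 2).over L))]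
  [MeasurableSpace (finAdelic (↥(maximalRealSubfield L)) L (IsCMField.complexConj L) 2 ((StdForm.antidiagonal 2).over L))] [BorelSpace (finAdelic (↥(maximalRealSubfield L)) L (IsCMField.complexConj L) 2 ((StdForm.antidiagonal 2).over L))]
  [MeasurableSpace (AdeleRing (𝓞 L) L)ˣ] [BorelSpace (AdeleRing (𝓞 L) L)ˣ]

/-- **THE (d)-REALNESS ROAD FOR THE WHOLE SCATTERING MATRIX AT A `c_G`-STABLE FINITE-INDEX LEVEL — (conj) CLOSED, LETTER-FREE UP TO `hdec` AND THE AXIS LETTER.**  For `χ` self-dual unitary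
trivial on `ℝ_{>0}`, a level `K′` with ★ p860918's binders and G7's (`[K_max : K′ ∩ K_max] < ∞`, `c_G(K′) ⊆ K′`, `conj ω = ω ∘ c_G`), under the socket `hdec` for every section of the block:
`c_G`-REAL bases `b` of `V(χ, K′, ω)` and `b′` of `V(χʷ, K′, ω)`, ONE pole set `P` (the union of the columns'), per column `i` ★ p860918's package `(q_i, Ec_i, qc_i)` with (E1)–(E4) and the
per-ball truncated families of the SAME `Ec_i` (all relative to `P`), the ENTRYWISE REFLECTION SYMMETRY `qc_{ij}(conj z) = conj qc_{ij}(z)` off `P ∪ conj P` PROVED (★ G7), and for every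
`σ₀ > 1`, GIVEN the axis letter (every `qc_{ij}` analytic on `Re z = ½`): `hreal_{ij}` for every entry and ONE finset `S ⊂ (½, σ₀)` of real poles with ONE open `U′ ⊇ {½ ≤ Re ≤ σ₀}` on which
EVERY `qc_{ij}` is holomorphic off `S`. [cite: MoeglinWaldspurger1995, IV.1.10–IV.1.11, IV.3.12 (a)] [cite: Langlands1976, §7] [cite: BernsteinLapid2019, Thm 2.3, §4] -/
theorem chi_scattering_real_poles_level_letterFree_cm_two
    (μ : Measure (quasiSplit (↥(maximalRealSubfield L)) L (IsCMField.complexConj L) 2).automorphicQuotient) [(quasiSplit (↥(maximalRealSubfield L)) L (IsCMField.complexConj L) 2).IsAutomorphicMeasure μ]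
    (νG : Measure (quasiSplit (↥(maximalRealSubfield L)) L (IsCMField.complexConj L) 2).Adelic) [νG.IsHaarMeasure] [νG.IsInvInvariant] [SFinite νG]
    (μK : Measure ↥((standardMaximalCompactGL 2 L).comap (adelicVal (↥(maximalRealSubfield L)) L (IsCMField.complexConj L) 2 ((StdForm.antidiagonal 2).over L)) : Subgroup (quasiSplit (↥(maximalRealSubfield L)) L (IsCMField.complexConj L) 2).Adelic)) [μK.IsHaarMeasure]
    (νI : Measure (AdeleRing (𝓞 L) L)ˣ) [νI.IsHaarMeasure]
    {𝓕I : Set (AdeleRing (𝓞 L) L)ˣ} (h𝓕I : IsIdeleClassDomain L 𝓕I)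
    (ν : Measure ↥(adelicUnipotent (↥(maximalRealSubfield L)) L (IsCMField.complexConj L) 2)) [ν.IsHaarMeasure] [ν.IsMulRightInvariant] [ν.IsInvInvariant]
    {𝓕 : Set ↥(adelicUnipotent (↥(maximalRealSubfield L)) L (IsCMField.complexConj L) 2)} (h𝓕N : IsFundamentalDomain ↥(rationalUnipotent (↥(maximalRealSubfield L)) L (IsCMField.complexConj L) 2) 𝓕 ν) (h𝓕1 : ν 𝓕 = 1)
    (h𝓕c : IsCompact (closure 𝓕))
    {β : (quasiSplit (↥(maximalRealSubfield L)) L (IsCMField.complexConj L) 2).Adelic → ℝ≥0∞} (hβ : IsCoveringWeight ↥((arithmeticBorel (↥(maximalRealSubfield L)) L (IsCMField.complexConj L) 2).map (quasiSplit (↥(maximalRealSubfield L)) L (IsCMField.complexConj L) 2).arithmeticSubgroup.subtype) β)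
    {μZ : Measure (borelQuotient (↥(maximalRealSubfield L)) L (IsCMField.complexConj L) 2)} [SFinite μZ]
    (hμZ : ∀ f : borelQuotient (↥(maximalRealSubfield L)) L (IsCMField.complexConj L) 2 → ℝ≥0∞, Measurable f → ∫⁻ z, f z ∂μZ = ∫⁻ g, β g * f (toBorelQuotient (↥(maximalRealSubfield L)) L (IsCMField.complexConj L) 2 g) ∂νG)
    -- the self-dual unitary character
    {χ : HeckeCharacter L} (hχ : χ.IsUnitary) (hρ : ∀ r : ℝ≥0ˣ, χ (posRealIdele L r) = 1) (hsd : reflectChar (IsCMField.complexConj L) χ = χ)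
    -- the LEVEL `(K′, ω)` (★ p860918's binders VERBATIM, owner K2-defs1): `ι(K_∞) ⊆ K′ ≤ K_max`, an open compact `U₀`-part with `ω = 1`, continuity of the sections, auxiliary Haar measures
    {K' : Subgroup (quasiSplit (↥(maximalRealSubfield L)) L (IsCMField.complexConj L) 2).Adelic} {ω : ↥K' → ℂ}
    (hK' : K' ≤ ((standardMaximalCompactGL 2 L).comap (adelicVal (↥(maximalRealSubfield L)) L (IsCMField.complexConj L) 2 ((StdForm.antidiagonal 2).over L)) : Subgroup (quasiSplit (↥(maximalRealSubfield L)) L (IsCMField.complexConj L) 2).Adelic))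
    (hKinf : ∀ k : arch (↥(maximalRealSubfield L)) L (IsCMField.complexConj L) 2 ((StdForm.antidiagonal 2).over L), adelicVal (↥(maximalRealSubfield L)) L (IsCMField.complexConj L) 2 ((StdForm.antidiagonal 2).over L) (archToAdelic (↥(maximalRealSubfield L)) L (IsCMField.complexConj L) 2 _ k) ∈ standardMaximalCompactGL 2 L →
      archToAdelic (↥(maximalRealSubfield L)) L (IsCMField.complexConj L) 2 _ k ∈ K')
    (U₀ : Subgroup (GL (Fin 2) (FiniteAdeleRing (𝓞 L) L))) (hU₀o : IsOpen (U₀ : Set (GL (Fin 2) (FiniteAdeleRing (𝓞 L) L)))) (hU₀c : IsCompact (U₀ : Set (GL (Fin 2) (FiniteAdeleRing (𝓞 L) L))))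
    (hU : ∀ b : finAdelic (↥(maximalRealSubfield L)) L (IsCMField.complexConj L) 2 ((StdForm.antidiagonal 2).over L), (b : GL (Fin 2) (FiniteAdeleRing (𝓞 L) L)) ∈ U₀ →
      ∃ hb : finAdelicToAdelic (↥(maximalRealSubfield L)) L (IsCMField.complexConj L) 2 ((StdForm.antidiagonal 2).over L) b ∈ K', ω ⟨_, hb⟩ = 1)
    (hVc : ∀ φ ∈ chiSectionSpace χ K' ω, Continuous φ)
    (μa : Measure (arch (↥(maximalRealSubfield L)) L (IsCMField.complexConj L) 2 ((StdForm.antidiagonal 2).over L))) [μa.IsHaarMeasure] [μa.IsMulRightInvariant]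
    (μf : Measure (finAdelic (↥(maximalRealSubfield L)) L (IsCMField.complexConj L) 2 ((StdForm.antidiagonal 2).over L))) [μf.IsHaarMeasure]
    -- the Galois twist `c_G` and G7's level letters (★ p860912's binders VERBATIM, owner K2E1-p13): finite index in `K_max`, `c_G(K′) ⊆ K′`, `conj ω = ω ∘ c_G`
    {cG : (quasiSplit (↥(maximalRealSubfield L)) L (IsCMField.complexConj L) 2).Adelic →* (quasiSplit (↥(maximalRealSubfield L)) L (IsCMField.complexConj L) 2).Adelic}
    (hcG : ∀ g, adelicVal (↥(maximalRealSubfield L)) L (IsCMField.complexConj L) 2 _ (cG g) =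
      Matrix.GeneralLinearGroup.map (conjAdele (↥(maximalRealSubfield L)) L (IsCMField.complexConj L)) (adelicVal (↥(maximalRealSubfield L)) L (IsCMField.complexConj L) 2 _ g))
    (hfi : (K'.subgroupOf ((standardMaximalCompactGL 2 L).comap (adelicVal (↥(maximalRealSubfield L)) L (IsCMField.complexConj L) 2 ((StdForm.antidiagonal 2).over L)) : Subgroup (quasiSplit (↥(maximalRealSubfield L)) L (IsCMField.complexConj L) 2).Adelic)).FiniteIndex)
    (hK : ∀ k : ↥K', cG (k : (quasiSplit (↥(maximalRealSubfield L)) L (IsCMField.complexConj L) 2).Adelic) ∈ K') (hω : ∀ k : ↥K', conj (ω k) = ω ⟨cG (k : (quasiSplit (↥(maximalRealSubfield L)) L (IsCMField.complexConj L) 2).Adelic), hK k⟩)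
    -- THE SOCKET: constant-term decay of `E(f_{z′}^φ)` above every truncation level, for EVERY section `φ` of the block (level payer ★ p860970, modulo the arch line symbol)
    (hdec : ∀ φ ∈ chiSectionSpace χ K' ω, ∀ T : ℝ≥0, 1 ≤ T → ∀ z' : ℂ, 1 < z'.re → ∃ M₁ : ℝ, ∀ g : (quasiSplit (↥(maximalRealSubfield L)) L (IsCMField.complexConj L) 2).Adelic, T < borelHeight g →
      ‖eisensteinSeriesU (flatSectionU φ z') g - borelConstantTerm ν 𝓕 (eisensteinSeriesU (flatSectionU φ z')) g‖ ≤ M₁) :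
    ∃ (n n' : ℕ) (b : Module.Basis (Fin n) ℂ ↥(chiSectionSpace χ K' ω)) (b' : Module.Basis (Fin n') ℂ ↥(chiSectionSpace (reflectChar (IsCMField.complexConj L) χ) K' ω)),
      (∀ i g, conj ((b i : (quasiSplit (↥(maximalRealSubfield L)) L (IsCMField.complexConj L) 2).Adelic → ℂ) g) = (b i : (quasiSplit (↥(maximalRealSubfield L)) L (IsCMField.complexConj L) 2).Adelic → ℂ) (cG g)) ∧
      (∀ j g, conj ((b' j : (quasiSplit (↥(maximalRealSubfield L)) L (IsCMField.complexConj L) 2).Adelic → ℂ) g) = (b' j : (quasiSplit (↥(maximalRealSubfield L)) L (IsCMField.complexConj L) 2).Adelic → ℂ) (cG g)) ∧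
      ∃ (q : Fin n → Fin n' → ℂ → ℂ) (Ec : Fin n → ℂ → (quasiSplit (↥(maximalRealSubfield L)) L (IsCMField.complexConj L) 2).Adelic → ℂ) (qc : Fin n → Fin n' → ℂ → ℂ) (P : Set ℂ),
        (∀ i j, DifferentiableOn ℂ (q i j) {z : ℂ | 1 < z.re}) ∧
        (∀ i (z : ℂ), 1 < z.re → (∑ j, q i j z • (b' j : (quasiSplit (↥(maximalRealSubfield L)) L (IsCMField.complexConj L) 2).Adelic → ℂ)) = ((((ν 𝓕).toReal⁻¹ : ℝ)) : ℂ) • (fun g : (quasiSplit (↥(maximalRealSubfield L)) L (IsCMField.complexConj L) 2).Adelic => (∫ v : ↥(adelicUnipotent (↥(maximalRealSubfield L)) L (IsCMField.complexConj L) 2), flatSectionU (b i : (quasiSplit (↥(maximalRealSubfield L)) L (IsCMField.complexConj L) 2).Adelic → ℂ) z ((quasiSplit (↥(maximalRealSubfield L)) L (IsCMField.complexConj L) 2).toAdelic (weylLongU ((IsCMField.complexConj L : L ≃ₐ[↥(maximalRealSubfield L)] L) : L →+* L) (rfl : (StdForm.antidiagonal 2).over L = (StdForm.antidiagonal 2).over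 L)) * ((v : (quasiSplit (↥(maximalRealSubfield L)) L (IsCMField.complexConj L) 2).Adelic) * g)) ∂ν) * (((borelHeight g : ℝ) : ℂ) ^ (z - 1)))) ∧
        (∀ i g, MeromorphicNFOn (fun z => Ec i z g) univ) ∧ (∀ i j, MeromorphicNFOn (qc i j) univ) ∧
        (∀ i (z : ℂ), 1 < z.re → Ec i z = eisensteinSeriesU (flatSectionU (b i : (quasiSplit (↥(maximalRealSubfield L)) L (IsCMField.complexConj L) 2).Adelic → ℂ) z)) ∧ (∀ i j (z : ℂ), 1 < z.re → qc i j z = q i j z) ∧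
        IsClosed P ∧ (∀ z₀ : ℂ, ∀ᶠ s in 𝓝[≠] z₀, s ∉ P) ∧ (∀ z ∈ P, z.re ≤ 1) ∧
        (∀ i g (z : ℂ), z ∉ P → AnalyticAt ℂ (fun z => Ec i z g) z) ∧ (∀ i j (z : ℂ), z ∉ P → AnalyticAt ℂ (qc i j) z) ∧
        (∀ i g, DifferentiableOn ℂ (fun z => Ec i z g) Pᶜ) ∧ (∀ i j, DifferentiableOn ℂ (qc i j) Pᶜ) ∧
        (∀ i (z : ℂ), z ∉ P → Continuous (Ec i z)) ∧
        (∀ i (m : ℕ), ∃ U : Set ℂ, IsOpen U ∧ U ⊆ Metric.ball (0 : ℂ) (m + 2) ∧ (∀ z₀ ∈ Metric.ball (0 : ℂ) (m + 2), ∀ᶠ s in 𝓝[≠] z₀, s ∈ U) ∧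
          ∃ T₀ : ℝ≥0, 1 ≤ T₀ ∧ ∃ Fam : ℂ → Lp ℂ 2 μ, DifferentiableOn ℂ Fam (U \ P) ∧
            ∀ z ∈ U \ P, ((Fam z : Lp ℂ 2 μ) : (quasiSplit (↥(maximalRealSubfield L)) L (IsCMField.complexConj L) 2).automorphicQuotient → ℂ) =ᵐ[μ] (quasiSplit (↥(maximalRealSubfield L)) L (IsCMField.complexConj L) 2).quotFun (truncation ν 𝓕 T₀ (Ec i z))) ∧
        -- (conj): the entrywise reflection symmetry, PROVED (★ G7 on the union pole set)
        (∀ i j (z : ℂ), z ∉ P → conj z ∉ P → qc i j (conj z) = conj (qc i j z)) ∧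
        -- the (d)-bill under the axis letter
        ∀ σ₀ : ℝ, 1 < σ₀ → (∀ i j (z : ℂ), z.re = 1 / 2 → AnalyticAt ℂ (qc i j) z) →
          (∀ i j (z : ℂ), ¬ AnalyticAt ℂ (qc i j) z → 1 / 2 < z.re → z.re ≤ σ₀ → z.im = 0 ∧ z.re < σ₀) ∧
            ∃ (S : Finset ℝ) (U' : Set ℂ), (∀ x ∈ S, (∃ i j, ¬ AnalyticAt ℂ (qc i j) (x : ℂ)) ∧ 1 / 2 < x ∧ x < σ₀) ∧ IsOpen U' ∧ {z : ℂ | 1 / 2 ≤ z.re ∧ z.re ≤ σ₀} ⊆ U' ∧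
              ∀ i j, DifferentiableOn ℂ (qc i j) (U' \ ((S.image fun x : ℝ => (x : ℂ)) : Set ℂ)) := by
  classical
  -- ★ G7: the `c_G`-real bases and the entrywise (conj) for EVERY package written in them
  obtain ⟨n, n', b, b', hb, hb', hG7⟩ := chi_scattering_matrix_conj_symm_level_final_cm_two L hcG ν 𝓕 K' hfi hK hω hsd hχ
  -- continuity and bounds of the basis sections (`χ`, `χʷ = χ` unitary)
  have hχ' : (reflectChar (IsCMField.complexConj L) χ).IsUnitary := by rw [hsd]; exact hχ
  have hVc' : ∀ φ ∈ chiSectionSpace (reflectChar (IsCMField.complexConj L) χ) K' ω, Continuous φ := by rw [hsd]; exact hVc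
  have hbic : ∀ i, Continuous (b i : (quasiSplit (↥(maximalRealSubfield L)) L (IsCMField.complexConj L) 2).Adelic → ℂ) := fun i => hVc _ (b i).2
  have hbjc : ∀ j, Continuous (b' j : (quasiSplit (↥(maximalRealSubfield L)) L (IsCMField.complexConj L) 2).Adelic → ℂ) := fun j => hVc' _ (b' j).2
  choose Mφ hMφ using fun i => exists_bound_of_isChiSection_of_isUnitary L 2 hχ (isChiSection_of_mem (b i).2) (hbic i)
  choose Mb₀ hMb₀ using fun j => exists_bound_of_isChiSection_of_isUnitary L 2 hχ' (isChiSection_of_mem (b' j).2) (hbjc j)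
  obtain ⟨Mb, hMb⟩ := Finite.exists_le Mb₀
  have hbM : ∀ j x, ‖(b' j : (quasiSplit (↥(maximalRealSubfield L)) L (IsCMField.complexConj L) 2).Adelic → ℂ) x‖ ≤ Mb := fun j x => (hMb₀ j x).trans (hMb j)
  -- per column `b i`: ★ p860918's package and families
  have h𝓕₀ : ν 𝓕 ≠ 0 := by rw [h𝓕1]; exact one_ne_zero
  have hpk := fun i => chiEisenstein_family_export_level_cm_two L μ νG ν h𝓕N h𝓕c h𝓕₀ hβ hμZ (b i).2 (hbic i) (hMφ i) hK' hKinf U₀ hU₀o hU₀c hU hVc μa μf b' hbjc hbM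
  choose q Ec qc P hq hqφ hEcNF hqNF hE1 hqcq hPc hPcd hPre hEan hqan hEdiff hqdiff hEcont hF using hpk
  -- ONE pole set: the union of the columns' (closed, co-discrete, inside `{Re ≤ 1}`); every clause is monotone in the pole set
  have hsub : ∀ i, P i ⊆ ⋃ i, P i := fun i => Set.subset_iUnion P i
  have hUc : IsClosed (⋃ i, P i) := isClosed_iUnion_of_finite hPc
  have hUcd : ∀ z₀ : ℂ, ∀ᶠ s in 𝓝[≠] z₀, s ∉ ⋃ i, P i := fun z₀ =>
    (Filter.eventually_all.2 fun i => hPcd i z₀).mono fun s hs h => by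
      obtain ⟨i, hi⟩ := Set.mem_iUnion.1 h
      exact hs i hi
  have hUre : ∀ z ∈ ⋃ i, P i, z.re ≤ 1 := fun z hz => by
    obtain ⟨i, hi⟩ := Set.mem_iUnion.1 hz
    exact hPre i z hi
  have hqaU : ∀ i j (z : ℂ), z ∉ (⋃ i, P i) → AnalyticAt ℂ (qc i j) z := fun i j z hz => hqan i j z fun h => hz (hsub i h)
  -- (conj) DISCHARGED: ★ G7 on the union pole set
  have hconj : ∀ i j (z : ℂ), z ∉ (⋃ i, P i) → conj z ∉ (⋃ i, P i) → qc i j (conj z) = conj (qc i j z) := hG7 hqφ hqcq hUc hUcd hUre hqaU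
  refine ⟨n, n', b, b', hb, hb', q, Ec, qc, ⋃ i, P i, hq, hqφ, hEcNF, hqNF, hE1, hqcq, hUc, hUcd, hUre, fun i g z hz => hEan i g z fun h => hz (hsub i h), hqaU,
    fun i g => (hEdiff i g).mono (Set.compl_subset_compl.2 (hsub i)), fun i j => (hqdiff i j).mono (Set.compl_subset_compl.2 (hsub i)),
    fun i z hz => hEcont i z fun h => hz (hsub i h), fun i m => ?_, hconj, fun σ₀ hσ₀ haxis => ?_⟩
  · obtain ⟨U, hUo', hUD, hUcd', T₀, hT₀, Fam, hFd, hFam⟩ := hF i m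
    exact ⟨U, hUo', hUD, hUcd', T₀, hT₀, Fam, hFd.mono (Set.sdiff_subset_sdiff_right (hsub i)), fun z hz => hFam z ⟨hz.1, fun h => hz.2 (hsub i h)⟩⟩
  · -- the per-ball families, skolemised over (column, ball)
    choose Uo hUoo hUoD hUocd T₀ hT₀ Fam hFd hFam using hF
    -- the `L²(K_max)` classes of the columns and of the coordinate basis (★ p861004 §1)
    haveI : CompactSpace ↥((standardMaximalCompactGL 2 L).comap (adelicVal (↥(maximalRealSubfield L)) L (IsCMField.complexConj L) 2 ((StdForm.antidiagonal 2).over L)) : Subgroup (quasiSplit (↥(maximalRealSubfield L)) L (IsCMField.complexConj L) 2).Adelic) :=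
      isCompact_iff_compactSpace.1 isCompact_comap_adelicVal_standardMaximalCompactGL
    haveI : IsFiniteMeasure μK := CompactSpace.isFiniteMeasure
    have hφKm : ∀ i, MemLp (fun k : ↥((standardMaximalCompactGL 2 L).comap (adelicVal (↥(maximalRealSubfield L)) L (IsCMField.complexConj L) 2 ((StdForm.antidiagonal 2).over L)) : Subgroup (quasiSplit (↥(maximalRealSubfield L)) L (IsCMField.complexConj L) 2).Adelic) => (b i : (quasiSplit (↥(maximalRealSubfield L)) L (IsCMField.complexConj L) 2).Adelic → ℂ) (k : (quasiSplit (↥(maximalRealSubfield L)) L (IsCMField.complexConj L) 2).Adelic)) 2 μK := fun i =>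
      MemLp.of_bound ((hbic i).comp continuous_subtype_val).aestronglyMeasurable (Mφ i) (Eventually.of_forall fun k => hMφ i _)
    have hbKm : ∀ j, MemLp (fun k : ↥((standardMaximalCompactGL 2 L).comap (adelicVal (↥(maximalRealSubfield L)) L (IsCMField.complexConj L) 2 ((StdForm.antidiagonal 2).over L)) : Subgroup (quasiSplit (↥(maximalRealSubfield L)) L (IsCMField.complexConj L) 2).Adelic) => (b' j : (quasiSplit (↥(maximalRealSubfield L)) L (IsCMField.complexConj L) 2).Adelic → ℂ) (k : (quasiSplit (↥(maximalRealSubfield L)) L (IsCMField.complexConj L) 2).Adelic)) 2 μK := fun j =>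
      MemLp.of_bound ((hbjc j).comp continuous_subtype_val).aestronglyMeasurable Mb (Eventually.of_forall fun k => hbM j _)
    have hφK : ∀ i, ((((hφKm i).toLp _ : Lp ℂ 2 μK)) : _ → ℂ) =ᵐ[μK] fun k => (b i : (quasiSplit (↥(maximalRealSubfield L)) L (IsCMField.complexConj L) 2).Adelic → ℂ) (k : (quasiSplit (↥(maximalRealSubfield L)) L (IsCMField.complexConj L) 2).Adelic) := fun i => MemLp.coeFn_toLp _
    have hbK : ∀ j, ((((hbKm j).toLp _ : Lp ℂ 2 μK)) : _ → ℂ) =ᵐ[μK] fun k => (b' j : (quasiSplit (↥(maximalRealSubfield L)) L (IsCMField.complexConj L) 2).Adelic → ℂ) (k : (quasiSplit (↥(maximalRealSubfield L)) L (IsCMField.complexConj L) 2).Adelic) := fun j => MemLp.coeFn_toLp _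
    have hφK0 : ∀ i, ((hφKm i).toLp _ : Lp ℂ 2 μK) ≠ 0 := fun i =>
      ne_zero_of_coeFn_ae_eq_of_continuous L μK (isChiSection_of_mem (b i).2) (hbic i) (fun h => b.ne_zero i (Subtype.ext h)) _ (hφK i)
    have hbKli : LinearIndependent ℂ (fun j => ((hbKm j).toLp _ : Lp ℂ 2 μK)) := linearIndependent_of_coeFn_ae_eq_of_continuous L μK b' hbjc _ hbK
    -- ★ p860981's matrix head on the union pole set
    obtain ⟨hreal, S, U', hS, hU'o, hU's, hd⟩ := chi_scattering_hs_of_model_level_cm_two_matrix L μ νG μK νI h𝓕I ν h𝓕N h𝓕1 h𝓕c hβ hχ hρ hsd (φ := fun i => (b i : (quasiSplit (↥(maximalRealSubfield L)) L (IsCMField.complexConj L) 2).Adelic → ℂ))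
      hbic (fun i => isChiSection_of_mem (b i).2) hMφ (fun j => (b' j : (quasiSplit (↥(maximalRealSubfield L)) L (IsCMField.complexConj L) 2).Adelic → ℂ)) (P := fun _ => ⋃ i, P i) hqφ hqNF hE1 hqcq (fun _ => hUc) (fun _ => hUcd) hqaU
      (fun i => ((hφKm i).toLp _ : Lp ℂ 2 μK)) hφK hφK0 (fun j => ((hbKm j).toLp _ : Lp ℂ 2 μK)) hbK hbKli (idelicBracket_pos νI h𝓕I) Uo hUoo hUocd T₀ hT₀ Fam
      (fun i m => (hFd i m).mono (Set.sdiff_subset_sdiff_right (hsub i))) (fun i m z hz => hFam i m z ⟨hz.1, fun h => hz.2 (hsub i h)⟩)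
      (fun i m z' hz' => hdec _ (b i).2 (T₀ i m) (hT₀ i m) z' hz') (fun _ => hUre) hconj haxis hσ₀
    exact ⟨hreal, S, U', hS, hU'o, hU's, hd⟩

end Summit.HodgeConjecture.HodgeConjecture.Cruxes.H413.K2E1ChiScatteringRealPolesLevelCMTwoLetterFree

end
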